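/-
Copyright: the b2b-balaban T⁴-continuum CRUX team, row NE7b OWNER lineage `t4-ne7b-p1` (gen 125). Project licence.
-/
import Summits.QuantumFields.BalabanUV.T4Continuum.Spine.NE7b.SupZdKernelNeumann

/-!
# BLOCKS COMPOSE ON `ℤ^d`: `blk n₂ ∘ blk n₁ = blk N` with `N + 1 = (n₁+1)(n₂+1)`; the `N`-block of `b` is the disjoint union of the
# `n₁`-blocks labelled by the `n₂`-block of `b`; block means, block-constant lifts and the coarse operators of ANY family of columns
# compose accordingly (`Q′_N = Q′_{n₂} ∘ Q′_{n₁}`, `ψ ∘ blk N = (ψ ∘ blk n₂) ∘ blk n₁`, `T^{(N)}(b,c) = (n₂+1)^{−d}Σ_{c′ ∈ B n₂ b}T^{(n₁)}(c′,c)`-type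
# readings), and `(blk n)^{[k]} = blk ((n+1)^k − 1)`: the combinatorial half of «k hard-constraint steps are ONE step at mesh `(n+1)^k − 1`», so
# that the column's mesh-uniform `ℤ^d` statements ((180)–(250), every one quantified over ALL meshes) are read at the composed mesh by name
# (row NE7b, node U5c; (27)∕(191) BY NAME; [folklore])

Cell `pub-balaban`, sub-cell `t4`, spine estimate NE7b (`T4WeightBudget.RelWeightBound`; the cell's OWN estimate — NOT PRINTED in
[Bałaban 1983–89], NOT PROVED).  Crux-route work under `Spine/NE7b/` by the row OWNER (`t4-ne7b-p1` gen 125, file (251)) under FREEZE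
(0)'s crux-prover clause; NOTHING of Bałaban's is named as a Lean object, valued or asserted; no `T4Continuum/Support` leaf typed; no `def`,
no notation (`N` is ANY natural with the displayed `N + 1 = (n₁+1)(n₂+1)` — no subtraction in the two-step statements; block means WRITTEN
OUT); zero `sorry`.  Imports (BY NAME): the OWNER's (217) `…SupZdKernelNeumann` (`blk_zero`, the mesh-zero reading; through it (27)
`B6QGQLower276`: `blk`, `B`, `side`, `mem_B`, `B_disjoint`, `side_facts`), Lean core's `Int.ediv_ediv_of_nonneg`, Mathlib's `Finset.sum_biUnion`,
`Function.iterate_succ_apply`.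

WHY (located).  § [NE7bP1-G123-HANDOFF] NEXT (3)(c): «the exact composition of hard-constraint Schur complements (`Q₂Q₁ = Q₁₂`,
`(Q₂T₁Q₂*)⁻¹ = T₁₂⁻¹`) reduces the k-step Hessian to the 1-step one with composed blocks, so mesh-uniformity in `n` may already be the
iterability the road needs».  The convex road has the abstract semigroup ((108) `…SupConvexStepSemigroup`: two fibre-critical steps are the
fibre-critical step of `Q₂ ∘ Q₁` on ANY finite carriers).  On `ℤ^d`, where the column's objects are indexed by the mesh `n` through `blk n` and
`B n`, the reduction needs the block maps THEMSELVES to compose — integer floor division composes for positive sides — and the blocks,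
block means and block-constant lifts with them.  This file is that bookkeeping, once, so that «the objects at mesh `N`» can be quoted as
«the two-step objects» without re-deriving anything; the analytic half (uniformity of the column's constants in the block-coupling `a`
along the composed soft steps, `a′ = a₁a₂∕(a₁ + (n₂+1)^{−d}a₂)`) is recorded as the successor's item, not claimed.

WHAT IS PROVED ([folklore]): §1 `side_comp`, **`blk_blk`** (`blk n₂ (blk n₁ p) = blk N p`), `lift_comp`; §2 `mem_B_comp`, **`B_comp`**
(`B N b = ⋃_{c ∈ B n₂ b} B n₁ c`, a `Finset.biUnion` of pairwise disjoint blocks), **`sum_B_comp`**, `vol_comp`, **`blockMean_comp`**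
(`Q′_N = Q′_{n₂} ∘ Q′_{n₁}` entrywise), `coarse_entry_comp` (the coarse operator of ANY family of columns at mesh `N` is the `n₂`-block mean of
its `n₁`-coarse rows); §3 **`blk_iterate`** ((217)'s `blk_zero` for `k = 0`) (`(blk n)^{[k]} p = blk ((n+1)^k − 1) p`); §4 toy.

HONEST (what this is NOT).  Combinatorics of floor division only; no Schur complement, no Hessian, no estimate; the soft-step composition
law and the `a`-uniformity audit of (216)∕(222)'s constants are NOT here (successor's (c2)∕(c3)); nothing of the torus ((110) has the torus
tower for the convex road); nothing of Bałaban's asserted.  BY-NAME EFFECT ON THE WALL: NONE.  NE7b NOT PRINTED ∕ NOT PROVED; spine PROVED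
0∕9; rung (B)+1 — the programme's measures remain FINITE-torus statements; NOT the mass gap, NOT Clay.  HONEST DEPENDENCY: continuum YM
on T⁴ ⇐ BetaPertH ∧ nine spine estimates (0∕9 proved); BetaPertH ⇐ (D1) ∧ (D4) ∧ CAP+tail; G-an2-4 gates asym, D1 and NE2∕3∕4.
-/

set_option autoImplicit false

noncomputable section

namespace Summit.QuantumFields.BalabanUV.T4Continuum.NE7b.SupZdBlockComposition

open Literature.MathematicalPhysics.QuantumFieldTheory.Balaban1983to89
open B6QGQLower276 (X blk B side mem_B B_disjoint side_facts)
open SupZdKernelNeumann (blk_zero)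

variable {d : ℕ}

/-! ## §1. The block maps compose -/

/-- **SIDES MULTIPLY**: `N + 1 = (n₁+1)(n₂+1)` ⟹ `side N = side n₁ · side n₂`. [folklore] -/
theorem side_comp {n₁ n₂ N : ℕ} (hN : N + 1 = (n₁ + 1) * (n₂ + 1)) : side N = side n₁ * side n₂ := by
  unfold side
  have h := congrArg (Nat.cast : ℕ → ℤ) hN
  push_cast at h
  linarith

/-- **BLOCK LABELS COMPOSE**: `blk n₂ (blk n₁ p) = blk N p` for `N + 1 = (n₁+1)(n₂+1)` — floor division by positive sides composes
(`(x ∕ s₁) ∕ s₂ = x ∕ (s₁s₂)`). [folklore] -/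
theorem blk_blk {n₁ n₂ N : ℕ} (hN : N + 1 = (n₁ + 1) * (n₂ + 1)) (p : X d) : blk n₂ (blk n₁ p) = blk N p := by
  funext i
  show p i / side n₁ / side n₂ = p i / side N
  rw [side_comp hN, Int.ediv_ediv_of_nonneg (side_facts n₁).1.le]

/-- **BLOCK-CONSTANT LIFTS COMPOSE**: `(ψ ∘ blk n₂) ∘ blk n₁ = ψ ∘ blk N`. [folklore] -/
theorem lift_comp {α : Type*} {n₁ n₂ N : ℕ} (hN : N + 1 = (n₁ + 1) * (n₂ + 1)) (ψ : X d → α) (p : X d) :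
    ψ (blk n₂ (blk n₁ p)) = ψ (blk N p) := by
  rw [blk_blk hN]

/-! ## §2. Blocks, block sums and block means compose -/

/-- Membership: `q ∈ B N b ↔ blk n₁ q ∈ B n₂ b`. [folklore] -/
theorem mem_B_comp {n₁ n₂ N : ℕ} (hN : N + 1 = (n₁ + 1) * (n₂ + 1)) {b q : X d} : q ∈ B N b ↔ blk n₁ q ∈ B n₂ b := by
  rw [mem_B, mem_B, blk_blk hN]

/-- **THE `N`-BLOCK IS THE UNION OF THE `n₁`-BLOCKS LABELLED BY THE `n₂`-BLOCK**: `B N b = ⋃_{c ∈ B n₂ b} B n₁ c` (pairwise disjoint by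
(27) `B_disjoint`). [folklore] -/
theorem B_comp {n₁ n₂ N : ℕ} (hN : N + 1 = (n₁ + 1) * (n₂ + 1)) (b : X d) : B N b = (B n₂ b).biUnion (B n₁) := by
  ext q
  rw [mem_B_comp hN, Finset.mem_biUnion]
  constructor
  · intro h
    exact ⟨blk n₁ q, h, mem_B.2 rfl⟩
  · rintro ⟨c, hc, hq⟩
    rw [mem_B.1 hq]
    exact hc

/-- **BLOCK SUMS COMPOSE**: `Σ_{q ∈ B N b}f(q) = Σ_{c ∈ B n₂ b}Σ_{q ∈ B n₁ c}f(q)`. [folklore] -/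
theorem sum_B_comp {n₁ n₂ N : ℕ} (hN : N + 1 = (n₁ + 1) * (n₂ + 1)) (b : X d) (f : X d → ℝ) :
    ∑ q ∈ B N b, f q = ∑ c ∈ B n₂ b, ∑ q ∈ B n₁ c, f q := by
  rw [B_comp hN b, Finset.sum_biUnion (fun c _ c' _ h => B_disjoint h)]

/-- Volumes multiply: `(N+1)^d = (n₁+1)^d(n₂+1)^d`. [folklore] -/
theorem vol_comp {n₁ n₂ N : ℕ} (hN : N + 1 = (n₁ + 1) * (n₂ + 1)) :
    ((N : ℝ) + 1) ^ d = ((n₁ : ℝ) + 1) ^ d * ((n₂ : ℝ) + 1) ^ d := by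
  rw [← mul_pow]
  congr 1
  exact_mod_cast hN

/-- **BLOCK MEANS COMPOSE** (`Q′_N = Q′_{n₂} ∘ Q′_{n₁}`, entrywise): `(N+1)^{−d}Σ_{q ∈ B N b}f(q) = (n₂+1)^{−d}Σ_{c ∈ B n₂ b}(n₁+1)^{−d}Σ_{q ∈ B n₁ c}f(q)`.
[folklore] -/
theorem blockMean_comp {n₁ n₂ N : ℕ} (hN : N + 1 = (n₁ + 1) * (n₂ + 1)) (b : X d) (f : X d → ℝ) :
    (((N : ℝ) + 1) ^ d)⁻¹ * ∑ q ∈ B N b, f q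
      = (((n₂ : ℝ) + 1) ^ d)⁻¹ * ∑ c ∈ B n₂ b, (((n₁ : ℝ) + 1) ^ d)⁻¹ * ∑ q ∈ B n₁ c, f q := by
  rw [sum_B_comp hN, vol_comp hN, ← Finset.mul_sum, mul_inv]
  ring

/-- **THE COARSE OPERATOR AT THE COMPOSED MESH** (ANY family of columns `Φ_c`): `T^{(N)}(b,c) = (N+1)^{−d}Σ_{q ∈ B N b}Φ_c(q)` is the
`n₂`-block mean of the `n₁`-coarse rows `(n₁+1)^{−d}Σ_{q ∈ B n₁ c′}Φ_c(q)` over `c′ ∈ B n₂ b`. [folklore] -/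
theorem coarse_entry_comp {n₁ n₂ N : ℕ} (hN : N + 1 = (n₁ + 1) * (n₂ + 1)) (Φ : X d → X d → ℝ) (b c : X d) :
    (((N : ℝ) + 1) ^ d)⁻¹ * ∑ q ∈ B N b, Φ c q
      = (((n₂ : ℝ) + 1) ^ d)⁻¹ * ∑ c' ∈ B n₂ b, (((n₁ : ℝ) + 1) ^ d)⁻¹ * ∑ q ∈ B n₁ c', Φ c q :=
  blockMean_comp hN b (Φ c)

/-! ## §3. Iterating one mesh -/

/-- **`k` STEPS OF MESH `n` ARE ONE STEP OF MESH `(n+1)^k − 1`**: `(blk n)^{[k]} p = blk ((n+1)^k − 1) p`. [folklore] -/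
theorem blk_iterate (n k : ℕ) (p : X d) : (blk n)^[k] p = blk ((n + 1) ^ k - 1) p := by
  induction k generalizing p with
  | zero => rw [Function.iterate_zero_apply, pow_zero, Nat.sub_self, blk_zero]
  | succ k ih =>
    rw [Function.iterate_succ_apply, ih (blk n p)]
    refine blk_blk (n₁ := n) (n₂ := (n + 1) ^ k - 1) (N := (n + 1) ^ (k + 1) - 1) ?_ p
    rw [Nat.sub_add_cancel (Nat.one_le_pow _ _ (Nat.succ_pos n)), Nat.sub_add_cancel (Nat.one_le_pow _ _ (Nat.succ_pos n)),
      pow_succ, mul_comm]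

/-! ## §4. Toy -/

/-- Toy (`d = 2`): two steps of mesh `2` (blocks of side `3`) are one step of mesh `8` (blocks of side `9`): `blk 2 (blk 2 p) = blk 8 p`. -/
example (p : X 2) : blk 2 (blk 2 p) = blk 8 p :=
  blk_blk (by norm_num) p

end Summit.QuantumFields.BalabanUV.T4Continuum.NE7b.SupZdBlockComposition
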